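import Summits.AtomisticToContinuum.BoseEinsteinCondensation.Theses.BECCutLineWeakDisorder
import Summits.AtomisticToContinuum.BoseEinsteinCondensation.Theses.BECClassicalWindow
import Literature.MathematicalPhysics.QuantumManyBody.GroundState
import Literature.MathematicalPhysics.QuantumManyBody.BoseGasDirichletMonotonicity
import Literature.MathematicalPhysics.QuantumManyBody.BoseGasThermodynamicLimitRuelle
import Summits.AtomisticToContinuum.BoseEinsteinCondensation.Theorems.BECCutLineWeakDisorderGroundStateRigidityHardCoreOfConnected
import Summits.AtomisticToContinuum.BoseEinsteinCondensation.Theorems.BECCutLineWeakDisorderGroundStateRigidityStubPosOfConnected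
import Summits.AtomisticToContinuum.BoseEinsteinCondensation.Theorems.BECCutLineWeakDisorderGroundStateRigidityLocBdd
import Summits.AtomisticToContinuum.BoseEinsteinCondensation.Theorems.BECCutLineWeakDisorderGroundStateRigidityUniqueEssBounded
import Mathlib.Analysis.Convex.PathConnected
import HarnessLib.Audit

/-!
# Line `insertion-floor` — ALTERNATIVE skeleton for crux `GroundStateRigidity`
(item stmt-AtomisticToContinuum-9072, shared by 8 routes; strategist seat
planner-cstrat-stmt-AtomisticToContinuum-9072-s1-0, 2026-08-17; registered with `--alt`, it does NOT
replace the lead's line `Sketch` (skeleton d694a874f8f0) and shares with it every LANDED stub)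

Crux (fixed, by name): `GroundStateRigidity` — for every repulsive finite-range `v` there is `ρ₀ > 0`
such that for `0 < ρ < ρ₀`, all large `N` and every `η > 0` some `δ > 0` makes any two `δ`-near-minimisers
of the Dirichlet energy in the box of side `(N/ρ)^{1/3}` `η`-close in `L²` up to a constant phase.

## Why a second line (what it dodges)

Line `Sketch` reduced the crux, kernel-checked, to two research stubs: Stub 21 `stub_cubeConnected`
(the dilute hard-sphere free region `F_b(N,L) = {X ∈ Λ_L^N : |xᵢ − xⱼ| > b}` is PATH-CONNECTED for
`N b³ ≤ c₀ L³` — Baryshnikov–Bubenik–Kahle's open question) and Stub 22 (the zoo). The lead's own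
structure theory (Cruxes/…/NOTES-c4-KERNEL.md §2) concludes that `CubeConnected` is "NOT safely true":
strictly-convex "vault foams" braced against the container are a credible sparse container-jammed
mechanism, i.e. a non-principal component of `F_b` at arbitrarily small `N b³/L³`. Connectivity is MORE
than the crux needs: uniqueness only needs that no non-principal component is ENERGY-MINIMISING. This
line types that weaker route (the "energy ordering" D4 of the previous census, now built):

* the PRINCIPAL component `P` := the `F_b`-path-component(s) of the well-separated configurations
  `W_{4b}` (all pairs `> 4b`, all particles `> 4b` from the walls) — ONE component by the parking lemma
  (Stub P, provable);
* TRAPS ARE CAGED (Stub T, the research kernel, pure geometry, WEAKER than `CubeConnected` and satisfied by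
  every trap mechanism on the table incl. vault foams): at `N b³ ≤ c₁ L³`, in every class of `F_b` not
  reaching `W_{4b}` some particle `i` is caged along some axis `k` at EVERY configuration of the class
  (every axis-`(i,k)` segment inside `F_b` through a point of the class has length `≤ K b`);
* WINDOW EXCLUSION (Stub X, provable, L–XL): if `E₀(N,L) < E₀(N−1,L) + π²/(Kb)²` then no ground state has
  mass on a clopen, permutation-invariant, caged part `T ⊆ F_b` — group extraction of the `N−1` uncaged
  particles (Literature `groundStateEnergy_mul_le_setLIntegral_group`, symmetric only in the group) plus
  the fibrewise one-dimensional Dirichlet bound `∫|∂f|² ≥ (π/Kb)² ∫|f|²` for the caged coordinate, run on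
  the cut `C¹` approximants of line `Sketch` (Stubs 15a–15g) restricted to the `Stab(i)`-invariant caged
  part, whose complement is priced by the bosonic floor;
* INSERTION (Stub I, provable, L; Boltzmann frame, no symmetrisation): from any `n`-boson trial state and
  `64(n+1)` cells of side `ℓ ≥ 4R₀` one builds a normalised `C¹` Dirichlet `(n+1)`-body function (NOT
  symmetric in the new particle) of energy `≤ 𝓔[Φ] + A/ℓ²` — the `y`-normalised superposition over the
  surely-empty cells, whose cross term vanishes identically;
* BOSONIC FLOOR (Stub B, provable, M): `E₀^D(N,L) ∫|g|² ≤ 𝓔[g]` for EVERY `C¹` Dirichlet `g`, symmetric or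
  not (Dirichlet port of Literature `BosonicFloor.lean`: symmetrise the density, `√(ε² + ∑_σ |g∘σ|²) − ε`).

Composition at fixed `N ≥ 2` (sorry-free below): B + I give `E₀(N) ≤ E₀(N−1) + A/ℓ²`; at density
`ρ < 1/(64 ℓ₀³)`, `ℓ₀ = 4 max(R₀,b) + K b √A`, this is `< E₀(N−1) + π²/(Kb)²`, so X (fed with T on
`T := F_b ∖ P`) makes every ground state vanish a.e. on `F_b ∖ P`; with Stub 14 (vanishing off `F_b`) every
ground state lives on `P`; `P` is chain-connected (Stub P + Stub 17), so the LANDED component-wise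
Perron–Frobenius package of line `Sketch` (Stubs 5b, 6, 15–20: `stub_posOfConnected`, `stub_uniqueOfPosOn`,
…) gives `HasUniqueGroundState`, and Stub 1 with Stub 0 gives rigidity. The other classes of `v` are the
landed theorems (`hasUniqueGroundState_of_essBounded`, `hasUniqueGroundState_of_essLocBdd`) and the zoo
stub (verbatim Stub 22 of `Sketch`).

Disproof.lean honoured: finite range is used by Stub I (`ℓ ≥ 4R₀`) and by `stub_finiteEnergyLowDensity`
(`E₀ < ⊤` eventually — `groundStateRigidity_false_without_finiteRange`); low density enters through
`N b³ ≤ c L³` (Stubs P, T) and `64 N ℓ₀³ ≤ L³` (Stub I) — `groundStateRigidity_false_at_all_densities`;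
the two-hard-spheres degeneracy `Negative/TwoHardSpheres` (`1/3 < L² < 1/2`) violates the density
hypotheses and is consistent with every stub (there both components are caged; what fails is the gap).

## Stubs (6 registered `sorry`s; everything else is landed and used BY NAME)

* `stub_parkedConnected` (P; geometry; L) · `stub_trapFibre` (T; geometry; RESEARCH KERNEL) ·
  `stub_bosonicFloor` (B; M) · `stub_insertion` (I; L) · `stub_windowExclusion` (X; L–XL) ·
  `stub_uniquenessKernelZoo` (Z; = Stub 22 of line `Sketch`, research).
-/

noncomputable section

open MeasureTheory Filter Metric
open scoped ENNReal NNReal Topology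

namespace Summit.AtomisticToContinuum.BoseEinsteinCondensation.Cruxes.GroundStateRigidity.InsertionFloor

open Literature.MathematicalPhysics.QuantumManyBody.BoseGas
open Summit.AtomisticToContinuum.BoseEinsteinCondensation.Theses.BECCutLineWeakDisorder
open Summit.AtomisticToContinuum.BoseEinsteinCondensation.Theorems.GroundStateRigidity

/-! ## Stubs -/

/-- **Stub P — parking lemma (provable geometry).** There is an absolute `c₂ > 0` such that for
`N b³ ≤ c₂ L³` any two WELL-SEPARATED labelled configurations of the open cube `(0,L)³` — all pair
distances `> 4b`, every particle farther than `4b` from every face — are joined by a continuous path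
inside the free region `{all pairs > b} ∩ Λ_L^N`. Proof sketch: park the particles one at a time on a
grid of pitch `5b` (pigeonhole: `≥ 9N` grid points, each particle spoils `≤ 8`), moving one particle
along a straight segment with spherical detours of radius `2b` around the (pairwise `> 4b`-separated,
wall-distant) obstacles; then pebble motion on the grid with a free buffer point realises every
relabelling. [folklore] -/
theorem stub_parkedConnected :
    ∃ c₂ : ℝ, 0 < c₂ ∧ ∀ (N : ℕ) (L b : ℝ), 0 < b → (N : ℝ) * b ^ 3 ≤ c₂ * L ^ 3 →
      ∀ X ∈ {Z : Config N | Z ∈ boxN N L ∧ (∀ i j : Fin N, i ≠ j → 4 * b < dist (Z i) (Z j)) ∧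
          ∀ (i : Fin N) (k : Fin 3), 4 * b < Z i k ∧ Z i k < L - 4 * b},
      ∀ Y ∈ {Z : Config N | Z ∈ boxN N L ∧ (∀ i j : Fin N, i ≠ j → 4 * b < dist (Z i) (Z j)) ∧
          ∀ (i : Fin N) (k : Fin 3), 4 * b < Z i k ∧ Z i k < L - 4 * b},
        JoinedIn {Z : Config N | Z ∈ boxN N L ∧ ∀ i j : Fin N, i ≠ j → b < dist (Z i) (Z j)} X Y := by
  sorry

/-- **Stub T — TRAPS ARE CAGED (the research kernel; pure discrete geometry, weaker than
`CubeConnected`).** There are absolute `K, c₁ > 0` such that for `N b³ ≤ c₁ L³`: if a configuration `X` of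
the free region `F_b(N,L)` is NOT joined inside `F_b` to any well-separated configuration (Stub P's
set), then some particle `i` is caged along some coordinate axis `k` throughout the path-class of `X`:
every axis-`(i,k)` segment `{Y + s e_{i,k} : s ∈ [s₁, s₂]}` (`s₁ ≤ 0 ≤ s₂`) lying inside `F_b` through a
configuration `Y` of the class has length `s₂ − s₁ ≤ K b`. Vacuous if `F_b` is connected
(`CubeConnected ⇒ T`); true for every trap mechanism on the table (container-braced jammed backbones,
notched rings, vault foams: backbone spheres rattle by `O(b)` with the others frozen); false only for a
LOOSE trap ("treadmill": a non-principal class in which every particle, at some configuration of the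
class, can slide `> K b` along every axis with the others fixed) — no mechanism known (lead c4
KERNEL §2–3; disprover Disproof.lean verdict). Why it might fail: a container-braced structure with
an intermittently uncaged yet never-escaping keystone.
[cite: BaryshnikovBubenikKahle2013, §6] -/
theorem stub_trapFibre :
    ∃ K c₁ : ℝ, 0 < K ∧ 0 < c₁ ∧ ∀ (N : ℕ) (L b : ℝ), 0 < b → (N : ℝ) * b ^ 3 ≤ c₁ * L ^ 3 →
      ∀ X ∈ {Z : Config N | Z ∈ boxN N L ∧ ∀ i j : Fin N, i ≠ j → b < dist (Z i) (Z j)},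
        (∀ W ∈ {Z : Config N | Z ∈ boxN N L ∧ (∀ i j : Fin N, i ≠ j → 4 * b < dist (Z i) (Z j)) ∧
            ∀ (i : Fin N) (k : Fin 3), 4 * b < Z i k ∧ Z i k < L - 4 * b},
          ¬ JoinedIn {Z : Config N | Z ∈ boxN N L ∧ ∀ i j : Fin N, i ≠ j → b < dist (Z i) (Z j)} X W) →
        ∃ (i : Fin N) (k : Fin 3), ∀ Y : Config N,
          JoinedIn {Z : Config N | Z ∈ boxN N L ∧ ∀ i j : Fin N, i ≠ j → b < dist (Z i) (Z j)} X Y →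
          ∀ s₁ s₂ : ℝ, s₁ ≤ 0 → 0 ≤ s₂ →
            (∀ s ∈ Set.Icc s₁ s₂, Y + Pi.single i (EuclideanSpace.single k s) ∈
              {Z : Config N | Z ∈ boxN N L ∧ ∀ i j : Fin N, i ≠ j → b < dist (Z i) (Z j)}) →
            s₂ - s₁ ≤ K * b := by
  sorry

/-- **Stub B — the bosonic floor for the Dirichlet box (provable; port of Literature `BosonicFloor`).**
For every measurable `v ≥ 0` (`⊤` allowed) and EVERY `C¹` function `g` vanishing off the open box
`Λ_L^N` — symmetric or not — `E₀^D(N, L) ∫|g|² ≤ ∫ (|∇g|² + ∑ v |g|²)`: "the bosonic ground-state energy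
is the absolute one". Proof: symmetrise the DENSITY, `G_ε = √(ε² + ∑_σ |g ∘ σ|²) − ε` is `C¹`, Dirichlet
and Bose-symmetric with `|∇G_ε|² ≤ ∑_σ |∇g|²∘σ` (convexity inequality for gradients,
`BosonicFloorSymmetrisation.lean`) and `V G_ε² ≤ ∑_σ V|g|²∘σ`; the variational principle for the
unnormalised `G_ε` (`groundStateEnergy_mul_normSq_le`) and `‖G_ε‖² → N! ‖g‖²`. [cite: LSSY2005, Ch. 2] -/
theorem stub_bosonicFloor :
    ∀ (N : ℕ) (L : ℝ) (v : ℝ → ℝ≥0∞), Measurable v →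
      ∀ g : Config N → ℂ, ContDiff ℝ 1 g → (∀ X, X ∉ boxN N L → g X = 0) →
        groundStateEnergy v N L * ∫⁻ X, (‖g X‖₊ : ℝ≥0∞) ^ 2 ≤
          ∫⁻ X, kineticDensity g X + interaction v X * (‖g X‖₊ : ℝ≥0∞) ^ 2 := by
  sorry

/-- **Stub I — the insertion bound in the Boltzmann frame (provable).** There is an absolute `A` such
that: for `n ≥ 1` bosons in `Λ_L` with a measurable pair potential of range `≤ R` (`v = 0` beyond `R`,
anything below, hard cores allowed), a cell size `ℓ ≥ 4R` and room for `64(n+1)` cells (`64(n+1)ℓ³ ≤ L³`),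
every trial state `Φ` of the `n` particles extends to a normalised `C¹` Dirichlet function `g` of `n+1`
particles (symmetric in the old ones only) with `𝓔[g] ≤ 𝓔[Φ] + A/ℓ²`. Construction: grid of `m³ ≥ 32(n+1)`
cells of side `s = L/m ∈ [ℓ, 2ℓ)`, inner cubes `c_in` of side `s/2` carrying the `C¹` bump
`∏ sin²(π·/w)`, smooth threat indicators `θ_c` (`= 1` within `R` of `c_in`, `= 0` beyond `R + s/8`,
each particle threatens `≤ 8` cells), `χ_c(X) = ∏ⱼ (1 − θ_c(xⱼ))`, `S = ∑_c χ_c² ≥ 16(n+1)`, and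
`g(X, y) = Φ(X) ∑_c χ_c(X) φ_c(y) / √S(X)`: `∫ g² dy = |Φ|²` identically, so the `X`-gradient cross term
vanishes, no old particle interacts with `y` on the support, and
`∑ⱼ ∫|∇_{xⱼ} F|² dy ≤ 4 ∑ⱼ ∑_c |∂ⱼχ_c|²/S ≤ 128 C₀²/s²`, `∫|∇_y F|² dy = 16π²/s²`.
[cite: LSSY2005, Ch. 2 (2.1)–(2.3)] -/
theorem stub_insertion :
    ∃ A : ℝ, 0 < A ∧ ∀ (n : ℕ) (L ℓ R : ℝ) (v : ℝ → ℝ≥0∞), 1 ≤ n → Measurable v → 0 ≤ R →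
      (∀ r : ℝ, R < r → v r = 0) → 4 * R ≤ ℓ → 0 < ℓ → 64 * ((n : ℝ) + 1) * ℓ ^ 3 ≤ L ^ 3 →
      ∀ Φ : TrialState n L, ∃ g : Config (n + 1) → ℂ, ContDiff ℝ 1 g ∧
        (∀ X, X ∉ boxN (n + 1) L → g X = 0) ∧ ∫⁻ X, (‖g X‖₊ : ℝ≥0∞) ^ 2 = 1 ∧
        ∫⁻ X, kineticDensity g X + interaction v X * (‖g X‖₊ : ℝ≥0∞) ^ 2 ≤
          energy v Φ + ENNReal.ofReal (A / ℓ ^ 2) := by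
  sorry

/-- **Stub X — window exclusion: a spectral gap plus a caged label exclude ground-state mass (provable,
L–XL).** Hard-core class `v = ⊤` on `[0,b]`, `v ≤ C` beyond `b`, `N ≥ 2`, `L > 0`; assume the bosonic
floor at `(v, N, L)` (Stub B, as a hypothesis). Let `T ⊆ F_b` be measurable, CLOPEN in `F_b` (closed under
`F_b`-paths), invariant under relabelling, and CAGED: every `X ∈ T` has a label `i` and an axis `k` such
that every axis-`(i,k)` segment inside `F_b` through any configuration of `X`'s class has length `≤ K b`.
If `E₀(N, L) < E₀(N−1, L) + π²/(Kb)²` then every ground state vanishes a.e. on `T`. Proof: if a ground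
state `Ψ` charges `T`, it charges `T_{i,k} := {X ∈ T : (i,k) cages X's class}` for some `(i,k)`, a clopen
`Stab(i)`-invariant set; the cut `C¹` approximants `χΦₘ → Ψ` of Stubs 15a–15g (landed) restricted to
`T_{i,k}` are `C¹`, Dirichlet, `Stab(i)`-symmetric, with `𝓔 ≤ E₀·mass + o(1)` (the complement costs
`≥ E₀·mass` by Stub B); group extraction of the `N−1` particles `≠ i`
(`groundStateEnergy_mul_le_setLIntegral_group`) and the fibrewise Dirichlet bound
`∫|∂_{i,k}f|² ≥ (π/Kb)² ∫|f|²` on each maximal non-vanishing axis interval (inside one class, hence of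
length `≤ Kb`) give `𝓔 ≥ (E₀(N−1) + π²/(Kb)²)·mass` — contradiction. [cite: ReedSimonIV1978, §XIII.12;
LSSY2005, (2.53)] -/
theorem stub_windowExclusion :
    ∀ (N : ℕ) (v : ℝ → ℝ≥0∞) (L b K : ℝ) (C : ℝ≥0), 2 ≤ N → 0 < L → 0 < b → 0 < K → Measurable v →
      (∀ s : ℝ, s ∈ Set.Icc 0 b → v s = ⊤) → (∀ s : ℝ, b < s → v s ≤ C) →
      (∀ g : Config N → ℂ, ContDiff ℝ 1 g → (∀ X, X ∉ boxN N L → g X = 0) →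
        groundStateEnergy v N L * ∫⁻ X, (‖g X‖₊ : ℝ≥0∞) ^ 2 ≤
          ∫⁻ X, kineticDensity g X + interaction v X * (‖g X‖₊ : ℝ≥0∞) ^ 2) →
      ∀ T : Set (Config N), MeasurableSet T →
        T ⊆ {Z : Config N | Z ∈ boxN N L ∧ ∀ i j : Fin N, i ≠ j → b < dist (Z i) (Z j)} →
        (∀ X ∈ T, ∀ Y : Config N,
          JoinedIn {Z : Config N | Z ∈ boxN N L ∧ ∀ i j : Fin N, i ≠ j → b < dist (Z i) (Z j)} X Y →
            Y ∈ T) →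
        (∀ (σ : Equiv.Perm (Fin N)) (X : Config N), X ∈ T → (X ∘ σ : Config N) ∈ T) →
        (∀ X ∈ T, ∃ (i : Fin N) (k : Fin 3), ∀ Y : Config N,
          JoinedIn {Z : Config N | Z ∈ boxN N L ∧ ∀ i j : Fin N, i ≠ j → b < dist (Z i) (Z j)} X Y →
          ∀ s₁ s₂ : ℝ, s₁ ≤ 0 → 0 ≤ s₂ →
            (∀ s ∈ Set.Icc s₁ s₂, Y + Pi.single i (EuclideanSpace.single k s) ∈
              {Z : Config N | Z ∈ boxN N L ∧ ∀ i j : Fin N, i ≠ j → b < dist (Z i) (Z j)}) →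
            s₂ - s₁ ≤ K * b) →
        groundStateEnergy v N L <
          groundStateEnergy v (N - 1) L + ENNReal.ofReal (Real.pi ^ 2 / (K * b) ^ 2) →
        ∀ Ψ : Config N → ℂ, IsGroundState v L Ψ → ∀ᵐ X : Config N, X ∈ T → Ψ X = 0 := by
  sorry

/-- **Stub Z — OPEN KERNEL (the zoo), verbatim Stub 22 of line `Sketch`:** uniqueness at low density
for walls that are NOT a plain hard core with an essentially bounded tail (hollow shells, hard cores
with an essentially unbounded finite shoulder, fat-Cantor walls, non-integrable finite walls). Reduces
(card `outer-wall-insertion-gap`) to bonded-sector exclusion by the same insertion/floor mechanism in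
the RELATIVE coordinate of a bonded pair plus this line's Stub T at the outermost wall radius; not
attempted here. [cite: ReedSimonIV1978, Thm XIII.48] -/
theorem stub_uniquenessKernelZoo :
    ∀ v : ℝ → ℝ≥0∞, IsRepulsiveFiniteRange v →
      (¬ ∀ r : ℝ, 0 < r → ∃ C : ℝ≥0, ∀ᵐ s : ℝ, r ≤ s → v s ≤ C) →
      (¬ ∃ b : ℝ, 0 < b ∧ ∃ C : ℝ≥0, (∀ᵐ s : ℝ, s ∈ Set.Icc 0 b → v s = ⊤) ∧
          (∀ᵐ s : ℝ, b < s → v s ≤ C)) →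
      ∃ ρ₀ : ℝ, 0 < ρ₀ ∧ ∀ ρ : ℝ, 0 < ρ → ρ < ρ₀ → ∀ᶠ N : ℕ in atTop,
        ∀ Ψ Φ : Config N → ℂ, IsGroundState v (sideLength ρ N) Ψ →
          IsGroundState v (sideLength ρ N) Φ →
          ∃ c : ℂ, ‖c‖ = 1 ∧ ∀ᵐ X : Config N, Φ X = c * Ψ X := by
  sorry

/-! ## Composition (sorry-free glue): the free region, the well-separated set, the principal component -/

/-- The free region `F_b(N, L) = {X ∈ Λ_L^N : |xᵢ − xⱼ| > b ∀ i ≠ j}` (reducible abbreviation of the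
inline set used by every stub). [folklore] -/
abbrev Free (N : ℕ) (L b : ℝ) : Set (Config N) :=
  {Z : Config N | Z ∈ boxN N L ∧ ∀ i j : Fin N, i ≠ j → b < dist (Z i) (Z j)}

/-- The well-separated configurations `W_{4b}`: all pairs `> 4b`, all particles `> 4b` from the faces.
[folklore] -/
abbrev Wsep (N : ℕ) (L b : ℝ) : Set (Config N) :=
  {Z : Config N | Z ∈ boxN N L ∧ (∀ i j : Fin N, i ≠ j → 4 * b < dist (Z i) (Z j)) ∧
    ∀ (i : Fin N) (k : Fin 3), 4 * b < Z i k ∧ Z i k < L - 4 * b}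

/-- The principal part `P` of the free region: the configurations joined inside `F_b` to a
well-separated one. [folklore] -/
abbrev Principal (N : ℕ) (L b : ℝ) : Set (Config N) :=
  {Z : Config N | Z ∈ Free N L b ∧ ∃ W ∈ Wsep N L b, JoinedIn (Free N L b) Z W}

variable {N : ℕ}

/-- The free region is invariant under relabelling. [folklore] -/
theorem comp_perm_mem_Free {L b : ℝ} (σ : Equiv.Perm (Fin N)) {X : Config N}
    (hX : X ∈ Free N L b) : (X ∘ σ : Config N) ∈ Free N L b := by
  refine ⟨fun i => hX.1 (σ i), fun i j hij => hX.2 (σ i) (σ j) ?_⟩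
  exact fun h => hij (σ.injective h)

/-- The well-separated set is invariant under relabelling. [folklore] -/
theorem comp_perm_mem_Wsep {L b : ℝ} (σ : Equiv.Perm (Fin N)) {X : Config N}
    (hX : X ∈ Wsep N L b) : (X ∘ σ : Config N) ∈ Wsep N L b := by
  refine ⟨fun i => hX.1 (σ i), fun i j hij => hX.2.1 (σ i) (σ j) ?_, fun i k => hX.2.2 (σ i) k⟩
  exact fun h => hij (σ.injective h)

/-- Paths in the free region are transported by relabelling. [folklore] -/
theorem joinedIn_Free_comp_perm {L b : ℝ} (σ : Equiv.Perm (Fin N)) {X Y : Config N}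
    (h : JoinedIn (Free N L b) X Y) :
    JoinedIn (Free N L b) (X ∘ σ : Config N) (Y ∘ σ : Config N) := by
  have hc : Continuous (fun Z : Config N => (Z ∘ σ : Config N)) :=
    continuous_pi fun i => continuous_apply (σ i)
  refine (h.map hc).mono ?_
  rintro _ ⟨Z, hZ, rfl⟩
  exact comp_perm_mem_Free σ hZ

/-- `P ⊆ F_b`. [folklore] -/
theorem Principal_subset (L b : ℝ) : Principal N L b ⊆ Free N L b := fun _ hZ => hZ.1

/-- `P` is closed under paths of the free region. [folklore] -/
theorem mem_Principal_of_joined {L b : ℝ} {X Y : Config N} (hX : X ∈ Principal N L b)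
    (h : JoinedIn (Free N L b) X Y) : Y ∈ Principal N L b := by
  obtain ⟨W, hW, hXW⟩ := hX.2
  exact ⟨h.target_mem, W, hW, h.symm.trans hXW⟩

/-- `P` is invariant under relabelling. [folklore] -/
theorem comp_perm_mem_Principal {L b : ℝ} (σ : Equiv.Perm (Fin N)) {X : Config N}
    (hX : X ∈ Principal N L b) : (X ∘ σ : Config N) ∈ Principal N L b := by
  obtain ⟨W, hW, hXW⟩ := hX.2
  exact ⟨comp_perm_mem_Free σ hX.1, W ∘ σ, comp_perm_mem_Wsep σ hW, joinedIn_Free_comp_perm σ hXW⟩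

/-- `P` is open (the free region is open and locally convex). [folklore] -/
theorem isOpen_Principal (L b : ℝ) : IsOpen (Principal N L b) := by
  rw [Metric.isOpen_iff]
  intro X hX
  obtain ⟨ε, hε, hball⟩ := Metric.isOpen_iff.1 (HardCoreOfConnected.isOpen_free N L b) X hX.1
  refine ⟨ε, hε, fun Y hY => ?_⟩
  have hseg : segment ℝ X Y ⊆ Free N L b :=
    ((convex_ball X ε).segment_subset (Metric.mem_ball_self hε) hY).trans hball
  exact mem_Principal_of_joined hX (JoinedIn.of_segment_subset hseg)

/-- The complement `T = F_b ∖ P` is measurable, clopen in `F_b` and relabelling invariant. [folklore] -/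
theorem trap_props (L b : ℝ) :
    MeasurableSet (Free N L b \ Principal N L b) ∧
    (∀ X ∈ Free N L b \ Principal N L b, ∀ Y : Config N,
      JoinedIn (Free N L b) X Y → Y ∈ Free N L b \ Principal N L b) ∧
    (∀ (σ : Equiv.Perm (Fin N)) (X : Config N), X ∈ Free N L b \ Principal N L b →
      (X ∘ σ : Config N) ∈ Free N L b \ Principal N L b) := by
  refine ⟨(HardCoreOfConnected.isOpen_free N L b).measurableSet.diff
    (isOpen_Principal L b).measurableSet, ?_, ?_⟩
  · intro X hX Y h
    exact ⟨h.target_mem, fun hY => hX.2 (mem_Principal_of_joined hY h.symm)⟩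
  · intro σ X hX
    refine ⟨comp_perm_mem_Free σ hX.1, fun h => hX.2 ?_⟩
    have h2 := comp_perm_mem_Principal σ.symm h
    have : ((X ∘ σ) ∘ σ.symm : Config N) = X := by
      funext i
      simp
    rwa [this] at h2

/-! ## Composition: exclusion of the traps, uniqueness on the principal component -/

/-- **Exclusion** (Stub X fed with Stub T on `T = F_b ∖ P`): in the hard-core class, under the caging
statement at `(N, L, b)` and the gap `E₀(N) < E₀(N−1) + π²/(Kb)²`, every ground state vanishes a.e. on
the non-principal part of the free region. [folklore] -/
theorem exclusion (n : ℕ) (v : ℝ → ℝ≥0∞) (L b K : ℝ) (C : ℝ≥0) (hL : 0 < L) (hb : 0 < b)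
    (hK : 0 < K) (hv : Measurable v) (hcore : ∀ s : ℝ, s ∈ Set.Icc 0 b → v s = ⊤)
    (htail : ∀ s : ℝ, b < s → v s ≤ C)
    (hSB : ∀ g : Config (n + 2) → ℂ, ContDiff ℝ 1 g → (∀ X, X ∉ boxN (n + 2) L → g X = 0) →
      groundStateEnergy v (n + 2) L * ∫⁻ X, (‖g X‖₊ : ℝ≥0∞) ^ 2 ≤
        ∫⁻ X, kineticDensity g X + interaction v X * (‖g X‖₊ : ℝ≥0∞) ^ 2)
    (hTT : ∀ X ∈ Free (n + 2) L b, (∀ W ∈ Wsep (n + 2) L b, ¬ JoinedIn (Free (n + 2) L b) X W) →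
      ∃ (i : Fin (n + 2)) (k : Fin 3), ∀ Y : Config (n + 2), JoinedIn (Free (n + 2) L b) X Y →
        ∀ s₁ s₂ : ℝ, s₁ ≤ 0 → 0 ≤ s₂ →
          (∀ s ∈ Set.Icc s₁ s₂, Y + Pi.single i (EuclideanSpace.single k s) ∈ Free (n + 2) L b) →
          s₂ - s₁ ≤ K * b)
    (hgap : groundStateEnergy v (n + 2) L <
      groundStateEnergy v (n + 1) L + ENNReal.ofReal (Real.pi ^ 2 / (K * b) ^ 2)) :
    ∀ Ψ : Config (n + 2) → ℂ, IsGroundState v L Ψ →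
      ∀ᵐ X : Config (n + 2), X ∈ Free (n + 2) L b → X ∉ Principal (n + 2) L b → Ψ X = 0 := by
  intro Ψ hΨ
  obtain ⟨hTm, hclopen, hsymm⟩ := trap_props (N := n + 2) L b
  have hwin : ∀ X ∈ Free (n + 2) L b \ Principal (n + 2) L b,
      ∃ (i : Fin (n + 2)) (k : Fin 3), ∀ Y : Config (n + 2), JoinedIn (Free (n + 2) L b) X Y →
        ∀ s₁ s₂ : ℝ, s₁ ≤ 0 → 0 ≤ s₂ →
          (∀ s ∈ Set.Icc s₁ s₂, Y + Pi.single i (EuclideanSpace.single k s) ∈ Free (n + 2) L b) →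
          s₂ - s₁ ≤ K * b :=
    fun X hX => hTT X hX.1 (fun W hW hJ => hX.2 ⟨hX.1, W, hW, hJ⟩)
  have h := stub_windowExclusion (n + 2) v L b K C (by omega) hL hb hK hv hcore htail hSB
    (Free (n + 2) L b \ Principal (n + 2) L b) hTm Set.diff_subset hclopen hsymm hwin hgap Ψ hΨ
  filter_upwards [h] with X hX hXF hXP
  exact hX ⟨hXF, hXP⟩

/-- **Uniqueness on the principal component** (the landed component-wise Perron–Frobenius package of
line `Sketch` — Stubs 5b, 6, 14–20 — run on the carrier `P`): in the hard-core class at `(N ≥ 1, L > 0)`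
with `E₀ < ⊤`, if the well-separated set lies in one path-class of `F_b` (Stub P) and every ground state
vanishes a.e. on `F_b ∖ P` (exclusion), the closed-form ground state is unique up to phase.
[cite: ReedSimonIV1978, §XIII.12 Thms XIII.44–47] -/
theorem uniqueOfExclusion (N : ℕ) (v : ℝ → ℝ≥0∞) (L b : ℝ) (C : ℝ≥0) (hN : 1 ≤ N) (hL : 0 < L)
    (hb : 0 < b) (hv : Measurable v) (hcore : ∀ s : ℝ, s ∈ Set.Icc 0 b → v s = ⊤)
    (htail : ∀ s : ℝ, b < s → v s ≤ C) (hE : groundStateEnergy v N L ≠ ⊤)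
    (hpark : ∀ X ∈ Wsep N L b, ∀ Y ∈ Wsep N L b, JoinedIn (Free N L b) X Y)
    (hexcl : ∀ Ψ : Config N → ℂ, IsGroundState v L Ψ →
      ∀ᵐ X : Config N, X ∈ Free N L b → X ∉ Principal N L b → Ψ X = 0) :
    HasUniqueGroundState v N L := by
  have hPm : MeasurableSet (Principal N L b) := (isOpen_Principal L b).measurableSet
  have hvan : ∀ Ψ : Config N → ℂ, IsGroundState v L Ψ →
      ∀ᵐ X : Config N, X ∉ Principal N L b → Ψ X = 0 := by
    intro Ψ hΨ
    filter_upwards [stub_vanishOffFree N v L b hb hcore Ψ hΨ, hexcl Ψ hΨ] with X h1 h2 hXP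
    by_cases hXF : X ∈ Free N L b
    · exact h2 hXF hXP
    · exact h1 hXF
  refine stub_uniqueOfPosOn stub_lincombGroundState N v L _ hPm
    (stub_existsNonnegGroundState stub_compactness N v L hE) hvan ?_
  intro Ψ₀ hΨ₀ hGS
  refine stub_posOfConnected (stub_chainedTube stub_localTubeCore) N v L b C hN hL hb hv hcore htail
    (groundStateEnergy_trunc_iSup_hardCore N v L b C hN hL hb hv hcore htail) _ hPm
    (Principal_subset L b) ?_ hvan Ψ₀ hΨ₀ hGS
  intro X hX Y hY
  refine stub_polygonalChain N L b X Y ?_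
  obtain ⟨W₁, hW₁, h₁⟩ := hX.2
  obtain ⟨W₂, hW₂, h₂⟩ := hY.2
  exact (h₁.trans (hpark W₁ hW₁ W₂ hW₂)).trans h₂.symm

/-- **The bosonic insertion gap** (Stub I + Stub B): `E₀(n+2, L) ≤ E₀(n+1, L) + A/ℓ²` whenever the box
has room for `64(n+2)` cells of side `ℓ ≥ 4R`, `R` the range of `v`. [cite: LSSY2005, Ch. 2] -/
theorem insertionGap (A : ℝ)
    (hINS : ∀ (n : ℕ) (L ℓ R : ℝ) (v : ℝ → ℝ≥0∞), 1 ≤ n → Measurable v → 0 ≤ R →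
      (∀ r : ℝ, R < r → v r = 0) → 4 * R ≤ ℓ → 0 < ℓ → 64 * ((n : ℝ) + 1) * ℓ ^ 3 ≤ L ^ 3 →
      ∀ Φ : TrialState n L, ∃ g : Config (n + 1) → ℂ, ContDiff ℝ 1 g ∧
        (∀ X, X ∉ boxN (n + 1) L → g X = 0) ∧ ∫⁻ X, (‖g X‖₊ : ℝ≥0∞) ^ 2 = 1 ∧
        ∫⁻ X, kineticDensity g X + interaction v X * (‖g X‖₊ : ℝ≥0∞) ^ 2 ≤
          energy v Φ + ENNReal.ofReal (A / ℓ ^ 2))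
    (n : ℕ) (L ℓ R : ℝ) (v : ℝ → ℝ≥0∞) (hv : Measurable v) (hR : 0 ≤ R)
    (hrange : ∀ r : ℝ, R < r → v r = 0) (hℓR : 4 * R ≤ ℓ) (hℓ : 0 < ℓ)
    (hdil : 64 * ((n : ℝ) + 2) * ℓ ^ 3 ≤ L ^ 3)
    (hSB : ∀ g : Config (n + 2) → ℂ, ContDiff ℝ 1 g → (∀ X, X ∉ boxN (n + 2) L → g X = 0) →
      groundStateEnergy v (n + 2) L * ∫⁻ X, (‖g X‖₊ : ℝ≥0∞) ^ 2 ≤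
        ∫⁻ X, kineticDensity g X + interaction v X * (‖g X‖₊ : ℝ≥0∞) ^ 2) :
    groundStateEnergy v (n + 2) L ≤
      groundStateEnergy v (n + 1) L + ENNReal.ofReal (A / ℓ ^ 2) := by
  refine ENNReal.le_of_forall_pos_le_add fun ε hε hfin => ?_
  have hE1 : groundStateEnergy v (n + 1) L ≠ ⊤ :=
    (lt_of_le_of_lt le_self_add hfin).ne
  have hεpos : (0 : ℝ≥0∞) < ε := ENNReal.coe_pos.2 hε
  have hlt : groundStateEnergy v (n + 1) L < groundStateEnergy v (n + 1) L + ε :=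
    ENNReal.lt_add_right hE1 hεpos.ne'
  obtain ⟨Φ, hΦ⟩ := iInf_lt_iff.1 hlt
  have hdil' : 64 * (((n + 1 : ℕ) : ℝ) + 1) * ℓ ^ 3 ≤ L ^ 3 := by
    have : ((n + 1 : ℕ) : ℝ) + 1 = (n : ℝ) + 2 := by push_cast; ring
    rw [this]; exact hdil
  obtain ⟨g, hg, hg0, hg1, hgE⟩ :=
    hINS (n + 1) L ℓ R v (by omega) hv hR hrange hℓR hℓ hdil' Φ
  have h1 := hSB g hg hg0
  rw [hg1, mul_one] at h1
  calc groundStateEnergy v (n + 2) L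
      ≤ ∫⁻ X, kineticDensity g X + interaction v X * (‖g X‖₊ : ℝ≥0∞) ^ 2 := h1
    _ ≤ energy v Φ + ENNReal.ofReal (A / ℓ ^ 2) := hgE
    _ ≤ (groundStateEnergy v (n + 1) L + ε) + ENNReal.ofReal (A / ℓ ^ 2) := by
        gcongr
    _ = groundStateEnergy v (n + 1) L + ENNReal.ofReal (A / ℓ ^ 2) + ε := by
        rw [add_right_comm]

/-- Density bookkeeping: `ρ < c / b³` gives `N b³ ≤ c L³` at `L = (N/ρ)^{1/3}`. [folklore] -/
theorem dens_of_lt {ρ c b : ℝ} (hρ : 0 < ρ) (hb : 0 < b) {N : ℕ} (hN : 0 < N)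
    (hρc : ρ < c / b ^ 3) : (N : ℝ) * b ^ 3 ≤ c * sideLength ρ N ^ 3 := by
  rw [Negative.sideLength_pow_three hρ hN]
  have hb3 : 0 < b ^ 3 := by positivity
  have h1 : ρ * b ^ 3 ≤ c := by
    rw [lt_div_iff₀ hb3] at hρc
    exact hρc.le
  have hNn : (0 : ℝ) ≤ N := by positivity
  calc (N : ℝ) * b ^ 3 = (N / ρ) * (ρ * b ^ 3) := by field_simp
    _ ≤ (N / ρ) * c := by gcongr
    _ = c * (N / ρ) := by ring

/-- **Uniqueness for the ESSENTIAL hard-core class at low density, eventually — by energy ordering**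
(Stubs P, T, B, I, X with the landed Stubs 0, 5a, 5b, 6, 14–20 of line `Sketch`): for `v = ⊤` a.e. on
`[0,b]`, `v ≤ C` a.e. beyond `b` (`b > 0`), at `ρ < ρ₀(v) = min(ρ₁(v), c₁/b³, c₂/b³, 1/(64ℓ₀³))`,
`ℓ₀ = 4 max(R₀, b) + K b √A`, and all large `N`, the ground state in the box `(N/ρ)^{1/3}` is unique up to
phase. [folklore] -/
theorem uniqueHardCoreEnergy (v : ℝ → ℝ≥0∞) (hv : IsRepulsiveFiniteRange v)
    (hHC : ∃ b : ℝ, 0 < b ∧ ∃ C : ℝ≥0, (∀ᵐ s : ℝ, s ∈ Set.Icc 0 b → v s = ⊤) ∧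
      (∀ᵐ s : ℝ, b < s → v s ≤ C)) :
    ∃ ρ₀ : ℝ, 0 < ρ₀ ∧ ∀ ρ : ℝ, 0 < ρ → ρ < ρ₀ → ∀ᶠ N : ℕ in atTop,
      HasUniqueGroundState v N (sideLength ρ N) := by
  obtain ⟨b, hb, C, hcoreae, htailae⟩ := hHC
  obtain ⟨c₂, hc₂, hpark⟩ := stub_parkedConnected
  obtain ⟨K, c₁, hK, hc₁, hTT⟩ := stub_trapFibre
  obtain ⟨A, hA, hINS⟩ := stub_insertion
  obtain ⟨ρ₁, hρ₁, h₁⟩ := stub_finiteEnergyLowDensity v hv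
  obtain ⟨R₀, hR₀, hvR⟩ := hv.exists_pos_range
  classical
  -- a pointwise representative off a null set of radii (as in line `Sketch`)
  set v' : ℝ → ℝ≥0∞ := fun s => if s ∈ Set.Icc 0 b then ⊤ else (if b < s then min (v s) C else v s)
    with hv'def
  set Sbad : Set ℝ := {s | s ∈ Set.Icc 0 b ∧ v s ≠ ⊤} ∪ {s | b < s ∧ (C : ℝ≥0∞) < v s} with hSbad
  have hSm : MeasurableSet Sbad := by
    refine MeasurableSet.union ?_ ?_
    · exact measurableSet_Icc.inter (hv.1 (measurableSet_singleton ⊤)).compl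
    · exact (measurableSet_lt measurable_const measurable_id).inter
        (measurableSet_lt measurable_const hv.1)
  have hS0 : volume Sbad = 0 := by
    rw [hSbad, measure_union_null_iff]
    constructor
    · rw [measure_eq_zero_iff_ae_notMem]
      filter_upwards [hcoreae] with s hs
      simp only [not_and, not_not]
      exact hs
    · rw [measure_eq_zero_iff_ae_notMem]
      filter_upwards [htailae] with s hs
      simp only [not_and, not_lt]
      exact hs
  have hvv' : ∀ r, r ∉ Sbad → v r = v' r := by
    intro r hr
    simp only [hSbad, Set.mem_union, Set.mem_setOf_eq, not_or, not_and, not_not, not_lt] at hr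
    by_cases h1 : r ∈ Set.Icc 0 b
    · simp only [hv'def]; rw [if_pos h1]; exact hr.1 h1
    · by_cases h2 : b < r
      · simp only [hv'def]; rw [if_neg h1, if_pos h2]; exact (min_eq_left (hr.2 h2)).symm
      · simp only [hv'def]; rw [if_neg h1, if_neg h2]
  have hv'm : Measurable v' := by
    refine Measurable.ite measurableSet_Icc measurable_const ?_
    exact Measurable.ite (measurableSet_lt measurable_const measurable_id)
      (hv.1.min measurable_const) hv.1
  have hcore' : ∀ s : ℝ, s ∈ Set.Icc 0 b → v' s = ⊤ := fun s hs => by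
    simp only [hv'def]; rw [if_pos hs]
  have htail' : ∀ s : ℝ, b < s → v' s ≤ C := by
    intro s hs
    have hs' : s ∉ Set.Icc 0 b := fun h => not_lt.2 h.2 hs
    simp only [hv'def]; rw [if_neg hs', if_pos hs]; exact min_le_right _ _
  -- the range of the representative
  set R : ℝ := max R₀ b with hRdef
  have hR : 0 ≤ R := le_max_of_le_right hb.le
  have hrange' : ∀ s : ℝ, R < s → v' s = 0 := by
    intro s hs
    have hbs : b < s := (le_max_right R₀ b).trans_lt hs
    have hR₀s : R₀ < s := (le_max_left R₀ b).trans_lt hs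
    have hs' : s ∉ Set.Icc 0 b := fun h => not_lt.2 h.2 hbs
    simp only [hv'def]; rw [if_neg hs', if_pos hbs, hvR s hR₀s]; exact min_eq_left bot_le
  -- the insertion scale and the density window
  set ℓ₀ : ℝ := 4 * R + K * b * Real.sqrt A with hℓ₀def
  have hKb : 0 < K * b := mul_pos hK hb
  have hsqA : 0 < Real.sqrt A := Real.sqrt_pos.2 hA
  have hℓ₀ : 0 < ℓ₀ := by
    have : 0 < K * b * Real.sqrt A := mul_pos hKb hsqA
    simp only [hℓ₀def]; linarith
  have hℓ₀R : 4 * R ≤ ℓ₀ := by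
    have : 0 ≤ K * b * Real.sqrt A := (mul_pos hKb hsqA).le
    simp only [hℓ₀def]; linarith
  have hgapR : A / ℓ₀ ^ 2 < Real.pi ^ 2 / (K * b) ^ 2 := by
    have h1 : K * b * Real.sqrt A ≤ ℓ₀ := by simp only [hℓ₀def]; linarith
    have h2 : (K * b) ^ 2 * A ≤ ℓ₀ ^ 2 := by
      have h3 : (K * b * Real.sqrt A) ^ 2 = (K * b) ^ 2 * A := by
        rw [mul_pow, Real.sq_sqrt hA.le]
      rw [← h3]
      exact pow_le_pow_left₀ (mul_pos hKb hsqA).le h1 2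
    have h4 : A / ℓ₀ ^ 2 ≤ A / ((K * b) ^ 2 * A) :=
      div_le_div_of_nonneg_left hA.le (by positivity) h2
    have h5 : A / ((K * b) ^ 2 * A) = 1 / (K * b) ^ 2 := by
      field_simp
    have h6 : (1 : ℝ) / (K * b) ^ 2 < Real.pi ^ 2 / (K * b) ^ 2 := by
      apply div_lt_div_of_pos_right _ (by positivity)
      nlinarith [Real.pi_gt_three]
    linarith
  set ρ₃ : ℝ := 1 / (64 * ℓ₀ ^ 3) with hρ₃def
  have hρ₃ : 0 < ρ₃ := by positivity
  refine ⟨min (min ρ₁ (c₁ / b ^ 3)) (min (c₂ / b ^ 3) ρ₃),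
    lt_min (lt_min hρ₁ (by positivity)) (lt_min (by positivity) hρ₃), fun ρ hρ hρm => ?_⟩
  have hρρ₁ : ρ < ρ₁ := (hρm.trans_le (min_le_left _ _)).trans_le (min_le_left _ _)
  have hρc₁ : ρ < c₁ / b ^ 3 := (hρm.trans_le (min_le_left _ _)).trans_le (min_le_right _ _)
  have hρc₂ : ρ < c₂ / b ^ 3 := (hρm.trans_le (min_le_right _ _)).trans_le (min_le_left _ _)
  have hρρ₃ : ρ < ρ₃ := (hρm.trans_le (min_le_right _ _)).trans_le (min_le_right _ _)
  filter_upwards [h₁ ρ hρ hρρ₁, eventually_ge_atTop 2] with N hE hN2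
  obtain ⟨n, rfl⟩ : ∃ n, N = n + 2 := ⟨N - 2, by omega⟩
  set L : ℝ := sideLength ρ (n + 2) with hLdef
  have hL : 0 < L := by
    simp only [hLdef]; unfold sideLength
    exact Real.rpow_pos_of_pos (div_pos (by positivity) hρ) _
  have hE' : groundStateEnergy v' (n + 2) L ≠ ⊤ := by
    rwa [← groundStateEnergy_congr_offNull hSm hS0 hvv' (n + 2) L]
  have hdens₁ : ((n + 2 : ℕ) : ℝ) * b ^ 3 ≤ c₁ * L ^ 3 := dens_of_lt hρ hb (by omega) hρc₁
  have hdens₂ : ((n + 2 : ℕ) : ℝ) * b ^ 3 ≤ c₂ * L ^ 3 := dens_of_lt hρ hb (by omega) hρc₂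
  have hdil : 64 * ((n : ℝ) + 2) * ℓ₀ ^ 3 ≤ L ^ 3 := by
    have hL3 : L ^ 3 = ((n + 2 : ℕ) : ℝ) / ρ := Negative.sideLength_pow_three hρ (by omega)
    have h64 : 64 * ℓ₀ ^ 3 ≤ 1 / ρ := by
      rw [le_div_iff₀ hρ]
      have h := hρρ₃
      rw [hρ₃def, lt_div_iff₀ (by positivity)] at h
      linarith
    have hn : (0 : ℝ) ≤ (n : ℝ) + 2 := by positivity
    calc 64 * ((n : ℝ) + 2) * ℓ₀ ^ 3 = ((n : ℝ) + 2) * (64 * ℓ₀ ^ 3) := by ring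
      _ ≤ ((n : ℝ) + 2) * (1 / ρ) := by gcongr
      _ = ((n + 2 : ℕ) : ℝ) / ρ := by push_cast; ring
      _ = L ^ 3 := hL3.symm
  -- bosonic floor, insertion gap, strict gap
  have hSB := stub_bosonicFloor (n + 2) L v' hv'm
  have hins := insertionGap A hINS n L ℓ₀ R v' hv'm hR hrange' hℓ₀R hℓ₀ hdil hSB
  have hE1 : groundStateEnergy v' (n + 1) L ≠ ⊤ :=
    ne_top_of_le_ne_top hE' (groundStateEnergy_le_succ hv'm (n + 1) L)
  have hgap : groundStateEnergy v' (n + 2) L <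
      groundStateEnergy v' (n + 1) L + ENNReal.ofReal (Real.pi ^ 2 / (K * b) ^ 2) := by
    refine hins.trans_lt ?_
    exact ENNReal.add_lt_add_left hE1 ((ENNReal.ofReal_lt_ofReal_iff (by positivity)).2 hgapR)
  -- exclusion of the traps and uniqueness on the principal component
  have hexcl := exclusion n v' L b K C hL hb hK hv'm hcore' htail' hSB
    (fun X hX hXW => hTT (n + 2) L b hb hdens₁ X hX hXW) hgap
  have hU : HasUniqueGroundState v' (n + 2) L :=
    uniqueOfExclusion (n + 2) v' L b C (by omega) hL hb hv'm hcore' htail' hE'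
      (fun X hX Y hY => hpark (n + 2) L b hb hdens₂ X hX Y hY) hexcl
  exact (hasUniqueGroundState_iff_offNull hSm hS0 hvv').2 hU

/-- **Uniqueness for admissible potentials with a wall at a positive radius, at low density** (class
(b/c)): the essential hard-core class by `uniqueHardCoreEnergy`, everything else by the zoo kernel
(Stub Z with Stubs 5a, 5b, 0). [folklore] -/
theorem uniqueWall (v : ℝ → ℝ≥0∞) (hv : IsRepulsiveFiniteRange v)
    (hb : ¬ ∀ r : ℝ, 0 < r → ∃ C : ℝ≥0, ∀ᵐ s : ℝ, r ≤ s → v s ≤ C) :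
    ∃ ρ₀ : ℝ, 0 < ρ₀ ∧ ∀ ρ : ℝ, 0 < ρ → ρ < ρ₀ → ∀ᶠ N : ℕ in atTop,
      HasUniqueGroundState v N (sideLength ρ N) := by
  by_cases hHC : ∃ b : ℝ, 0 < b ∧ ∃ C : ℝ≥0, (∀ᵐ s : ℝ, s ∈ Set.Icc 0 b → v s = ⊤) ∧
      (∀ᵐ s : ℝ, b < s → v s ≤ C)
  · exact uniqueHardCoreEnergy v hv hHC
  · obtain ⟨ρ₁, hρ₁, h₁⟩ := stub_finiteEnergyLowDensity v hv
    obtain ⟨ρ₂, hρ₂, h₂⟩ := stub_uniquenessKernelZoo v hv hb hHC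
    refine ⟨min ρ₁ ρ₂, lt_min hρ₁ hρ₂, fun ρ hρ hρm => ?_⟩
    filter_upwards [h₁ ρ hρ (hρm.trans_le (min_le_left _ _)),
      h₂ ρ hρ (hρm.trans_le (min_le_right _ _))] with N hE hU
    exact ⟨stub_existsNonnegGroundState stub_compactness N v (sideLength ρ N) hE, hU⟩

/-! ## Composition (sorry-free): the stubs give the crux BY NAME -/

/-- **Eventual uniqueness** for every admissible `v`: essentially bounded `v` (landed
`hasUniqueGroundState_of_essBounded`, every density), class (a) `v` essentially locally bounded on
`(0, ∞)` (landed `hasUniqueGroundState_of_essLocBdd` with `stub_finiteEnergyLowDensity`), walls by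
`uniqueWall`. [folklore] -/
theorem eventualUniqueness (v : ℝ → ℝ≥0∞) (hv : IsRepulsiveFiniteRange v) :
    ∃ ρ₀ : ℝ, 0 < ρ₀ ∧ ∀ ρ : ℝ, 0 < ρ → ρ < ρ₀ → ∀ᶠ N : ℕ in atTop,
      HasUniqueGroundState v N (sideLength ρ N) := by
  by_cases hbdd : ∃ C : ℝ≥0, ∀ᵐ r : ℝ, v r ≤ C
  · obtain ⟨C, hCae⟩ := hbdd
    refine ⟨1, one_pos, fun ρ hρ _ => ?_⟩
    filter_upwards [eventually_ge_atTop 1] with N hN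
    have hL : 0 < sideLength ρ N := by
      unfold sideLength
      exact Real.rpow_pos_of_pos (div_pos (by exact_mod_cast hN) hρ) _
    exact hasUniqueGroundState_of_essBounded N v C (sideLength ρ N) hN hv.1 hCae hL
  · by_cases hlb : ∀ r : ℝ, 0 < r → ∃ C : ℝ≥0, ∀ᵐ s : ℝ, r ≤ s → v s ≤ C
    · obtain ⟨ρ₁, hρ₁, h₁⟩ := stub_finiteEnergyLowDensity v hv
      refine ⟨ρ₁, hρ₁, fun ρ hρ hρm => ?_⟩
      filter_upwards [h₁ ρ hρ hρm, eventually_ge_atTop 1] with N hE hN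
      have hL : 0 < sideLength ρ N := by
        unfold sideLength
        exact Real.rpow_pos_of_pos (div_pos (by exact_mod_cast hN) hρ) _
      exact hasUniqueGroundState_of_essLocBdd N v (sideLength ρ N) hN hL hv.1 hlb hE
    · exact uniqueWall v hv hlb

/-- **`GroundStateRigidity` from the six registered stubs** (kernel-checked glue, no `sorry` of its
own): eventual uniqueness (above) and rigidity-from-uniqueness (landed Stub 1 fed with Stub 0).
[cite: ReedSimonIV1978, §XIII.12] -/
theorem GroundStateRigidity_of : GroundStateRigidity := by
  intro v hv
  obtain ⟨ρ₀, hρ₀, hU⟩ := eventualUniqueness v hv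
  refine ⟨ρ₀, hρ₀, fun ρ hρ hρ₀' => ?_⟩
  filter_upwards [hU ρ hρ hρ₀'] with N hN
  intro η hη
  exact stub_rigidityOfUnique stub_compactness v N (sideLength ρ N) hN η hη

/-- The same composition read against the verbatim-shared decl of route `BECClassicalWindow` (the decl
the crux skeleton is registered against; the two `def`s are syntactically identical).
[cite: ReedSimonIV1978, §XIII.12] -/
theorem GroundStateRigidity_proof :
    Summit.AtomisticToContinuum.BoseEinsteinCondensation.Theses.BECClassicalWindow.GroundStateRigidity :=
  GroundStateRigidity_of

end Summit.AtomisticToContinuum.BoseEinsteinCondensation.Cruxes.GroundStateRigidity.InsertionFloor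

end
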